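import Literature.Barriers.Schanuel.LinearSubgroupMethodLimit
import Literature.Barriers.Schanuel.LinearSubgroupMethodLimitLemmas

/-!
# Roy 1995, Theorem 3.4 — coordinate-free abstract form (`Roy1995.finrank_add_finrank_le`)

`Literature/Barriers/Schanuel/LinearSubgroupMethodLimitInduction.lean` proves the coordinate-free
abstract form `Roy1995.finrank_add_finrank_le` of Roy's Theorem 3.4 — "`dim_F E + dim_K W ≤
4 · dim_K ⟨E⟩_K`" for ANY finite-dimensional `K`-space `W` with parametrised rational forms
(below), over any field extension `K/F` — by Roy's induction on the rank, and records (as a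
closing `example`, which adds no constant) that it specialises to the barrier-catalogue
declaration `Literature.Barriers.Schanuel.LinearSubgroupMethodLimit`
(= `Literature.Barriers.Schanuel.roy1995_thm_3_4`) of
`Literature/Barriers/Schanuel/LinearSubgroupMethodLimit.lean`.  The DISCHARGE of that named fact
is `roy1995_thm_3_4_holds` / `linearSubgroupMethodLimit_holds` of
`Literature/Barriers/Schanuel/LinearSubgroupMethodLimitProofs.lean` (an independent formalisation
on coefficient triples `Fin 3 → Fin l → F`, whose general form is `Roy1995.add_le_four_mul_rank`);
the present development is coordinate-free and shares no declarations with it.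

> **Theorem 3.4** [Roy1995, p. 66]. Let `d, l` be positive integers, let `λ₁, λ₂, λ₃ ∈ K` be
> linearly independent over `ℚ̄`, and let `M` be a `d × l` matrix with coefficients in
> `⟨λ₁, λ₂, λ₃⟩_ℚ` whose rows are `ℚ`-linearly independent and whose columns are `ℚ`-linearly
> independent. Then its rank `r` satisfies `4r ≥ d + l`.

The proof is Roy's (p. 66), organised as in the module docstring of
`Literature/Barriers/Schanuel/LinearSubgroupMethodLimitLemmas.lean`: the abstract statement
`Roy1995.finrank_add_finrank_le` ("`dim_F E + dim_K W ≤ 4 dim_K ⟨E⟩_K`" for a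
finite-dimensional `K`-space `W` with parametrised rational forms `Ψ : V → W^*`, an `F`-subspace
`E` on which all rational forms take values in `L₀` and which no non-zero rational form kills)
is proved by induction on the rank: Roy's local step (`Roy1995.local_step`, `d₁ + l₁ ≤ 4 r₁`)
and the passage to `W ⧸ U` (`Roy1995.quot_*`, "`PMQ = (M₁ 0; M₃ M₂)` … by induction on `r`").
The matrix statement is the case `W = ℂ^l`, `V = ℚ^l`, `Ψ c = (x ↦ ∑ c_j x_j)`, `E` = the
`ℚ`-span of the rows, `L₀ = ⟨λ₁, λ₂, λ₃⟩_ℚ`; the multiplier property of `L₀` is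
`exists_eq_ratCast_of_mul_mem_span` (statement file), the base change `ℚ^l ⊂ ℂ^l` of linear
independence is `Roy1995.linearIndependent_algebraMap_pi`.

## References

* [Roy1995] D. Roy, *Points whose coordinates are logarithms of algebraic numbers on algebraic
  varieties*, Acta Math. 175 (1995) 49–73, §3.2, Theorem 3.4 and its proof, p. 66.
-/

noncomputable section

open Module Submodule

namespace Literature.Barriers.Schanuel

namespace Roy1995

universe u v

section Quot

variable {F K : Type*} [Field F] [Field K] [Algebra F K]
variable {W : Type u} [AddCommGroup W] [Module K W]
variable {V : Type*} [AddCommGroup V] [Module F V]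

/-! ### Passage to the quotient `W ⧸ U`

The rational forms of `W ⧸ U` are parametrised by `V_U = Ψ⁻¹(ann U)`, an `F`-subspace of `V`,
through any `F`-linear `Ψ'` with `Ψ' a (w mod U) = Ψ a w`; such a `Ψ'` exists
(`exists_quot_param`), and the axioms and hypotheses descend (`quot_*`). -/

/-- The rational forms for the quotient: every `Ψ a` vanishing on `U` factors through `W ⧸ U`,
`F`-linearly in `a`. [folklore] -/
theorem exists_quot_param (U : Submodule K W) (Ψ : V →ₗ[F] Module.Dual K W) :
    ∃ Ψ' : ↥((U.dualAnnihilator.restrictScalars F).comap Ψ) →ₗ[F] Module.Dual K (W ⧸ U),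
      ∀ a (w : W), Ψ' a (Submodule.Quotient.mk w) = Ψ (a : V) w := by
  have hker : ∀ a : ↥((U.dualAnnihilator.restrictScalars F).comap Ψ),
      U ≤ LinearMap.ker (Ψ (a : V)) := by
    intro a w hw
    have ha := a.2
    rw [Submodule.mem_comap, Submodule.restrictScalars_mem, Submodule.mem_dualAnnihilator] at ha
    exact ha w hw
  refine ⟨{ toFun := fun a => U.liftQ (Ψ (a : V)) (hker a)
            map_add' := ?_
            map_smul' := ?_ }, ?_⟩
  · intro a b
    apply LinearMap.ext
    intro x
    obtain ⟨w, rfl⟩ := Submodule.Quotient.mk_surjective U x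
    simp
  · intro c a
    apply LinearMap.ext
    intro x
    obtain ⟨w, rfl⟩ := Submodule.Quotient.mk_surjective U x
    simp
  · intro a w
    rfl

/-- Axiom 1 descends: `F`-independent families in `V_U` give `K`-independent forms on `W ⧸ U`
(pull back along the surjection `W → W ⧸ U`). [folklore] -/
theorem quot_indep (U : Submodule K W) (Ψ : V →ₗ[F] Module.Dual K W)
    (hΨ : ∀ (n : ℕ) (c : Fin n → V), LinearIndependent F c →
      LinearIndependent K (fun i => Ψ (c i)))
    (Ψ' : ↥((U.dualAnnihilator.restrictScalars F).comap Ψ) →ₗ[F] Module.Dual K (W ⧸ U))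
    (hΨ' : ∀ a (w : W), Ψ' a (Submodule.Quotient.mk w) = Ψ (a : V) w)
    (n : ℕ) (c : Fin n → ↥((U.dualAnnihilator.restrictScalars F).comap Ψ))
    (hc : LinearIndependent F c) : LinearIndependent K (fun i => Ψ' (c i)) := by
  have hcV : LinearIndependent F (((U.dualAnnihilator.restrictScalars F).comap Ψ).subtype ∘ c) :=
    hc.map' _ (Submodule.ker_subtype _)
  have hK := hΨ _ _ hcV
  have heq : (fun i => Ψ ((((U.dualAnnihilator.restrictScalars F).comap Ψ).subtype ∘ c) i)) =
      U.mkQ.dualMap ∘ (fun i => Ψ' (c i)) := by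
    funext i
    apply LinearMap.ext
    intro w
    simp [hΨ']
  rw [heq] at hK
  exact LinearIndependent.of_comp _ hK

/-- Axiom 2 descends: `dim_K (W ⧸ U) ≤ dim_F V_U`, because the forms `A` whose common kernel
is `U` (`dim_K W = dim_F A + dim_K U`) lie in `V_U`. [folklore] -/
theorem quot_finrank [FiniteDimensional K W] [Module.Finite F V] (U : Submodule K W)
    (Ψ : V →ₗ[F] Module.Dual K W) (A : Submodule F V) (hAU : ∀ a ∈ A, ∀ w ∈ U, Ψ a w = 0)
    (hWA : finrank K W ≤ finrank F A + finrank K U) :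
    finrank K (W ⧸ U) ≤ finrank F ↥((U.dualAnnihilator.restrictScalars F).comap Ψ) := by
  have hq := Submodule.finrank_quotient_add_finrank U
  have hA : A ≤ (U.dualAnnihilator.restrictScalars F).comap Ψ := by
    intro a ha
    rw [Submodule.mem_comap, Submodule.restrictScalars_mem, Submodule.mem_dualAnnihilator]
    exact hAU a ha
  have := Submodule.finrank_mono hA
  omega

/-- "Entries in `L₀`" descends to the image `E'` of `E` in `W ⧸ U`. [folklore] -/
theorem quot_mem [Module F W] [IsScalarTower F K W] (L₀ : Submodule F K) (U : Submodule K W)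
    (Ψ : V →ₗ[F] Module.Dual K W) (E : Submodule F W) (hE : ∀ a, ∀ e ∈ E, Ψ a e ∈ L₀)
    (Ψ' : ↥((U.dualAnnihilator.restrictScalars F).comap Ψ) →ₗ[F] Module.Dual K (W ⧸ U))
    (hΨ' : ∀ a (w : W), Ψ' a (Submodule.Quotient.mk w) = Ψ (a : V) w)
    (a : ↥((U.dualAnnihilator.restrictScalars F).comap Ψ)) (e' : W ⧸ U)
    (he' : e' ∈ E.map (U.mkQ.restrictScalars F)) : Ψ' a e' ∈ L₀ := by
  obtain ⟨e, he, rfl⟩ := Submodule.mem_map.mp he'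
  rw [LinearMap.restrictScalars_apply, Submodule.mkQ_apply, hΨ']
  exact hE _ e he

/-- "Columns independent" descends: a rational form of `W ⧸ U` killing `E'` is zero. [folklore] -/
theorem quot_col [Module F W] [IsScalarTower F K W] (U : Submodule K W)
    (Ψ : V →ₗ[F] Module.Dual K W) (E : Submodule F W)
    (hcol : ∀ a, (∀ e ∈ E, Ψ a e = 0) → a = 0)
    (Ψ' : ↥((U.dualAnnihilator.restrictScalars F).comap Ψ) →ₗ[F] Module.Dual K (W ⧸ U))
    (hΨ' : ∀ a (w : W), Ψ' a (Submodule.Quotient.mk w) = Ψ (a : V) w)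
    (a : ↥((U.dualAnnihilator.restrictScalars F).comap Ψ))
    (h0 : ∀ e' ∈ E.map (U.mkQ.restrictScalars F), Ψ' a e' = 0) : a = 0 := by
  have ha : (a : V) = 0 := by
    apply hcol
    intro e he
    rw [← hΨ']
    exact h0 _ (Submodule.mem_map_of_mem he)
  exact Subtype.ext ha

/-- Dimension count for `E`: `dim_F E = dim_F (E ∩ U) + dim_F E'` (rank–nullity for
`E → W ⧸ U`). [folklore] -/
theorem quot_finrank_E [Module F W] [IsScalarTower F K W] (U : Submodule K W)
    (E : Submodule F W) [Module.Finite F E] :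
    finrank F ↥(E ⊓ U.restrictScalars F) + finrank F ↥(E.map (U.mkQ.restrictScalars F)) =
      finrank F E := by
  have h1 := LinearMap.finrank_range_add_finrank_ker ((U.mkQ.restrictScalars F).domRestrict E)
  rw [LinearMap.range_domRestrict, LinearMap.ker_domRestrict] at h1
  have hk : (LinearMap.ker (U.mkQ.restrictScalars F)).comap E.subtype =
      (E ⊓ U.restrictScalars F).comap E.subtype := by
    ext x
    simp
  rw [hk, (Submodule.comapSubtypeEquivOfLe (inf_le_left : E ⊓ U.restrictScalars F ≤ E)).finrank_eq]
    at h1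
  omega

/-- Dimension count for the ranks: `r₂ + r₁ ≤ r`, i.e.
`dim_K ⟨E'⟩_K + dim_K ⟨E ∩ U⟩_K ≤ dim_K ⟨E⟩_K` ("the rank `r₂` of `M₂` is `≤ r - r₁`").
[cite: Roy1995, §3.2 proof of Theorem 3.4] -/
theorem quot_finrank_span [FiniteDimensional K W] [Module F W] [IsScalarTower F K W]
    (U : Submodule K W) (E : Submodule F W) :
    finrank K (span K ((E.map (U.mkQ.restrictScalars F) : Submodule F (W ⧸ U)) : Set (W ⧸ U))) +
      finrank K (span K ((E ⊓ U.restrictScalars F : Submodule F W) : Set W)) ≤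
      finrank K (span K (E : Set W)) := by
  have hspan' : span K ((E.map (U.mkQ.restrictScalars F) : Submodule F (W ⧸ U)) : Set (W ⧸ U)) =
      (span K (E : Set W)).map U.mkQ := by
    rw [Submodule.map_coe, LinearMap.coe_restrictScalars, Submodule.span_image]
  have h1 := LinearMap.finrank_range_add_finrank_ker (U.mkQ.domRestrict (span K (E : Set W)))
  rw [LinearMap.range_domRestrict, LinearMap.ker_domRestrict, Submodule.ker_mkQ] at h1
  have hle1 : span K ((E ⊓ U.restrictScalars F : Submodule F W) : Set W) ≤ span K (E : Set W) :=
    Submodule.span_mono fun x hx => hx.1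
  have hle2 : span K ((E ⊓ U.restrictScalars F : Submodule F W) : Set W) ≤ U := by
    rw [Submodule.span_le]
    exact fun x hx => hx.2
  have h2 : finrank K (span K ((E ⊓ U.restrictScalars F : Submodule F W) : Set W)) ≤
      finrank K (U.comap (span K (E : Set W)).subtype) :=
    calc finrank K (span K ((E ⊓ U.restrictScalars F : Submodule F W) : Set W))
        = finrank K ((span K ((E ⊓ U.restrictScalars F : Submodule F W) : Set W)).comap
            (span K (E : Set W)).subtype) :=
          (Submodule.comapSubtypeEquivOfLe hle1).finrank_eq.symm
      _ ≤ finrank K (U.comap (span K (E : Set W)).subtype) :=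
          Submodule.finrank_mono (Submodule.comap_mono hle2)
  rw [hspan']
  omega

end Quot

/-! ### The abstract theorem, by induction on the rank -/

section Main

variable {F K : Type*} [Field F] [Field K] [Algebra F K]

/-- The degenerate case `E = 0`: then `V = 0` (no non-zero form may kill `E`), so `W = 0`.
[folklore] -/
theorem finrank_add_finrank_le_of_eq_bot
    {W : Type u} [AddCommGroup W] [Module K W] [Module F W] [FiniteDimensional K W]
    {V : Type v} [AddCommGroup V] [Module F V] [Module.Finite F V]
    (Ψ : V →ₗ[F] Module.Dual K W) (hdim : finrank K W ≤ finrank F V)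
    (E : Submodule F W) (hcol : ∀ a, (∀ e ∈ E, Ψ a e = 0) → a = 0) (hE0 : E = ⊥) :
    finrank F E + finrank K W ≤ 4 * finrank K (span K (E : Set W)) := by
  have hV : ∀ a : V, a = 0 := fun a => hcol a fun e he => by
    rw [hE0, Submodule.mem_bot] at he
    rw [he, map_zero]
  haveI : Subsingleton V := subsingleton_of_forall_eq 0 hV
  have hV0 : finrank F V = 0 := Module.finrank_zero_of_subsingleton
  have hEf : finrank F E = 0 := by rw [hE0, finrank_bot]
  omega

/-- **Roy 1995, Theorem 3.4, abstract form.** Let `K ⊇ F` be fields, `L₀ ≤ K` an `F`-subspace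
of dimension `≤ 3` with the multiplier property `t L₀ ⊆ L₀ ⇒ t ∈ F`.  Let `W` be a
finite-dimensional `K`-space with parametrised rational forms `Ψ : V →ₗ[F] W^*`
(`F`-independent ⇒ `K`-independent, `dim_K W ≤ dim_F V`), and `E ≤ W` a finite-dimensional
`F`-subspace such that every rational form maps `E` into `L₀` and no non-zero rational form
kills `E`.  Then `dim_F E + dim_K W ≤ 4 · dim_K ⟨E⟩_K`.  (Induction on `r ≥ dim_K ⟨E⟩_K`.)
Relation to `Literature/Barriers/Schanuel/LinearSubgroupMethodLimitProofs.lean`: there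
`Roy1995.finrank_add_le` is the same inequality for `W = K^l` with `E` encoded by coefficient
triples `Fin 3 → Fin l → F` (`L₀ = ⟨λ₁, λ₂, λ₃⟩_F`), and `Roy1995.add_le_four_mul_rank` its matrix
form; use those for matrices over `⟨λ₁, λ₂, λ₃⟩_F`, and the present statement when `W` or the
rational structure is not given in coordinates (it only asks `dim_F L₀ ≤ 3` and the multiplier
property of `L₀`). [cite: Roy1995, Theorem 3.4 and its proof, p. 66] -/
theorem finrank_add_finrank_le (L₀ : Submodule F K) [Module.Finite F L₀] (h3 : finrank F L₀ ≤ 3)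
    (hrig : ∀ t : K, (∀ x ∈ L₀, t * x ∈ L₀) → ∃ c : F, t = algebraMap F K c) (r : ℕ) :
    ∀ (W : Type u) [AddCommGroup W] [Module K W] [Module F W] [IsScalarTower F K W]
      [FiniteDimensional K W] (V : Type v) [AddCommGroup V] [Module F V] [Module.Finite F V]
      (Ψ : V →ₗ[F] Module.Dual K W),
      (∀ (n : ℕ) (c : Fin n → V), LinearIndependent F c →
        LinearIndependent K (fun i => Ψ (c i))) →
      finrank K W ≤ finrank F V →
      ∀ (E : Submodule F W) [Module.Finite F E], (∀ a, ∀ e ∈ E, Ψ a e ∈ L₀) →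
      (∀ a, (∀ e ∈ E, Ψ a e = 0) → a = 0) →
      finrank K (span K (E : Set W)) ≤ r →
      finrank F E + finrank K W ≤ 4 * finrank K (span K (E : Set W)) := by
  induction r with
  | zero =>
    intro W _ _ _ _ _ V _ _ _ Ψ hΨ hdim E _ hE hcol hr
    have hS : span K (E : Set W) = ⊥ := Submodule.finrank_eq_zero.mp (Nat.le_zero.mp hr)
    have hE0 : E = ⊥ := by
      rw [eq_bot_iff]
      intro e he
      have : e ∈ span K (E : Set W) := Submodule.subset_span he
      rw [hS] at this
      exact this
    exact finrank_add_finrank_le_of_eq_bot Ψ hdim E hcol hE0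
  | succ r ih =>
    intro W _ _ _ _ _ V _ _ _ Ψ hΨ hdim E _ hE hcol hr
    by_cases hE0 : E = ⊥
    · exact finrank_add_finrank_le_of_eq_bot Ψ hdim E hcol hE0
    obtain ⟨U, A, hAU, hWA, hr1, hloc⟩ := local_step L₀ h3 hrig Ψ hΨ hdim E hE hE0
    obtain ⟨Ψ', hΨ'⟩ := exists_quot_param U Ψ
    have hdS := quot_finrank_span (F := F) U E
    have hdE := quot_finrank_E U E
    have hq := Submodule.finrank_quotient_add_finrank U
    have ih' := ih (W ⧸ U) ↥((U.dualAnnihilator.restrictScalars F).comap Ψ) Ψ'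
      (quot_indep U Ψ hΨ Ψ' hΨ') (quot_finrank U Ψ A hAU hWA)
      (E.map (U.mkQ.restrictScalars F)) (quot_mem L₀ U Ψ E hE Ψ' hΨ')
      (quot_col U Ψ E hcol Ψ' hΨ') (by omega)
    omega

end Main

end Roy1995

/-! ### The matrix statement -/

open Roy1995 in
/- **Specialisation to Roy 1995, Theorem 3.4** (the barrier declaration
`LinearSubgroupMethodLimit` = `roy1995_thm_3_4`), kept as an `example` (no constant: the named
fact is discharged by `roy1995_thm_3_4_holds` / `linearSubgroupMethodLimit_holds` of the Proofs
file): the abstract theorem with `W = ℂ^l`, `V = ℚ^l`, `Ψ c = (x ↦ ∑ c_j x_j)`, `E` = the `ℚ`-span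
of the rows, `L₀ = ⟨λ₁, λ₂, λ₃⟩_ℚ` (multiplier property: `exists_eq_ratCast_of_mul_mem_span`),
witnessing that all hypotheses of `Roy1995.finrank_add_finrank_le` are met in Roy's setting.
[cite: Roy1995, Theorem 3.4, p. 66] -/
example : LinearSubgroupMethodLimit := by
  intro d l _hd _hl lam hlam M hM hrows hcols
  -- `L₀ = ⟨λ₁, λ₂, λ₃⟩_ℚ`: dimension `≤ 3` and the multiplier property
  set L₀ : Submodule ℚ ℂ := Submodule.span ℚ (Set.range lam) with hL₀
  haveI : Module.Finite ℚ L₀ := FiniteDimensional.span_of_finite ℚ (Set.finite_range lam)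
  have h3 : finrank ℚ L₀ ≤ 3 := (finrank_range_le_card lam).trans_eq (Fintype.card_fin 3)
  have hrig : ∀ t : ℂ, (∀ x ∈ L₀, t * x ∈ L₀) → ∃ c : ℚ, t = algebraMap ℚ ℂ c := by
    intro t ht
    obtain ⟨q, hq⟩ := exists_eq_ratCast_of_mul_mem_span hlam ht
    exact ⟨q, by rw [hq, eq_ratCast]⟩
  -- the rational forms of `ℂ^l`: `Ψ c = (x ↦ ∑ c_j x_j)`, `c ∈ ℚ^l`
  let Φ : (Fin l → ℂ) →ₗ[ℂ] Module.Dual ℂ (Fin l → ℂ) :=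
    Fintype.linearCombination ℂ (fun j => LinearMap.proj j)
  have hΦ : ∀ x y, Φ x y = x ⬝ᵥ y := by
    intro x y
    simp [Φ, Fintype.linearCombination_apply, dotProduct]
  have hΦinj : Function.Injective Φ := by
    intro x y hxy
    funext j
    have := congrArg (fun φ => φ (Pi.single j 1)) hxy
    simpa [hΦ] using this
  let ι : (Fin l → ℚ) →ₗ[ℚ] (Fin l → ℂ) := (Algebra.linearMap ℚ ℂ).compLeft (Fin l)
  let Ψ : (Fin l → ℚ) →ₗ[ℚ] Module.Dual ℂ (Fin l → ℂ) := (Φ.restrictScalars ℚ) ∘ₗ ι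
  have hΨΦ : ∀ c, Ψ c = Φ (fun j => algebraMap ℚ ℂ (c j)) := fun c => rfl
  have hΨ : ∀ c y, Ψ c y = ∑ j, (c j : ℂ) * y j := by
    intro c y
    rw [hΨΦ, hΦ]
    simp [dotProduct]
  -- axiom 1: `ℚ`-independent coefficient vectors give `ℂ`-independent forms
  have hΨind : ∀ (n : ℕ) (c : Fin n → Fin l → ℚ), LinearIndependent ℚ c →
      LinearIndependent ℂ (fun i => Ψ (c i)) := by
    intro n c hc
    have h1 : LinearIndependent ℂ (fun i j => algebraMap ℚ ℂ (c i j)) :=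
      linearIndependent_algebraMap_pi hc
    exact h1.map_injOn Φ hΦinj.injOn
  -- axiom 2
  have hdim : finrank ℂ (Fin l → ℂ) ≤ finrank ℚ (Fin l → ℚ) := by simp
  -- `E` = the `ℚ`-span of the rows; entries in `L₀`; columns independent
  let E : Submodule ℚ (Fin l → ℂ) := Submodule.span ℚ (Set.range fun i => M i)
  haveI : Module.Finite ℚ E := FiniteDimensional.span_of_finite ℚ (Set.finite_range _)
  have hE : ∀ a, ∀ e ∈ E, Ψ a e ∈ L₀ := by
    intro a e he
    have hle : E ≤ L₀.comap ((Ψ a).restrictScalars ℚ) := by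
      rw [Submodule.span_le]
      rintro _ ⟨i, rfl⟩
      show Ψ a (M i) ∈ L₀
      rw [hΨ]
      refine Submodule.sum_mem _ fun j _ => ?_
      have hmem : (a j : ℚ) • M i j ∈ L₀ := Submodule.smul_mem _ _ (hM i j)
      rwa [Rat.smul_def] at hmem
    exact hle he
  have hcol : ∀ a, (∀ e ∈ E, Ψ a e = 0) → a = 0 := by
    intro a ha
    have hc := Fintype.linearIndependent_iff.mp hcols a ?_
    · exact funext hc
    funext i
    have h0 := ha (M i) (Submodule.subset_span ⟨i, rfl⟩)
    rw [hΨ] at h0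
    simp only [Finset.sum_apply, Pi.smul_apply, Matrix.transpose_apply, Pi.zero_apply]
    simpa [Rat.smul_def] using h0
  -- the abstract theorem
  have key := Roy1995.finrank_add_finrank_le L₀ h3 hrig
    (finrank ℂ (span ℂ (E : Set (Fin l → ℂ)))) (Fin l → ℂ) (Fin l → ℚ) Ψ hΨind hdim E hE
    hcol le_rfl
  have hdE : finrank ℚ E = d := by
    simp only [E]
    rw [finrank_span_eq_card hrows, Fintype.card_fin]
  have hspan : finrank ℂ (span ℂ (E : Set (Fin l → ℂ))) = M.rank := by
    simp only [E]
    rw [Submodule.span_span_of_tower, Matrix.rank_eq_finrank_span_row]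
    rfl
  rw [hdE, hspan, Module.finrank_fin_fun] at key
  exact key

end Literature.Barriers.Schanuel
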